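import Summits.QuantumFields.BalabanUV.T4Continuum.Spine.NE1p.DressedRootComposition

/-!
# T⁴ programme, spine estimate NE1′ (node O3b/H2) — THE SAME-LATTICE FACE of the composition route: ROOT-C OF RECORD with the
# carried function of a generation FIXED (no scale index), its birth slice asked AT BIRTH ONLY, per-generation chart radii, and
# the transport input displayed as the NORMALISED DEFECT RATE of the attaining pairs (two-sided level regularity on the lattice)

Cell `pub-balaban`, sub-cell `t4`, BINDER-OWNERS row NE1′; owner lineage t4-ne1p-p1 (PROVER seat P1, «RG-trajectory comparison»),
generation 25; kernel form of the owner memo `HOME/b2b-balaban-t4-ne1p-p1/g25/OWNER-ANSWERS-g25.md` §2 («SAME-LATTICE READING»).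
ADDITIVE — imports `Spine/NE1p/DressedRootComposition` (p217849) ONLY; THEOREMS ONLY (no `def`, no `def … : Prop`).

WHY THIS FILE.  The composition-route END of record (`DressedRootComposition.transportLeaf_of_composition`, skeleton v1.4) indexes
the carried function of generation `(b,k′)` by the later scale `k` — `Fn b k′ k`, «the birth function composed with the value maps» —
and asks its birth slice `hsl` AT EVERY `k ≥ k′` with sup `a^{k−k′}·gen` (leaf F-1′; at `k > k′` booked as the open estimate
(VAL-θ)-lite «containment WITH margin of the value map»).  On [Balaban1987RGI]'s own representation the later scale does NOT
change the function: (1.6) p. 261 «A_k(U_k) = −(1/g_k²)A(U_k) + Σ_{j=0}^{k−1}{−β_{j+1}(g_j)A(U_k) + [𝐄^{(j+1)}(g_j, U_k) −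
𝐄^{(j+1)}(g_j, 1)]}» — every term born at step `j+1` is EVALUATED AT the current background `U_k`; p. 261 «The function
𝐄^{(j)}(g_{j−1}, U_j) is a result of an integration in the j-th step, after a subtraction of the previous action evaluated at U_j»;
p. 263 «the action A_k(U) defined on the space U_k(ε₀), which is contained in all the spaces U^c_j(X, α₀, α₁)»; (3.39) p. 278 the
reproducing identity «U_j(□₀, exp iQ(L⁻¹η𝐇_{k+1})) = … = U_{k+1}(□₀, M˙(𝐔))^{(vū_{k+1}v_j)⁻¹}»; and what print PROVES about its
maps for the transport of ITS terms is containment + two-sided regularity read in the birth frame: (3.36)/Lemma 4 (3.53) p. 280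
«(U_j(□₀, exp i(τB + B′)), J_j(□₀, exp i(τB + B′)))|_X ∈ U^c_j(X, α₀, α₁) … The functions in (3.53) are analytic on the above
spaces», (3.41) p. 278 «|∂ exp iξ𝐇_j(□₀, Q(L⁻¹η𝐇_{k+1})) − 1| … < (1+3β)α₀(L^{j−1}η)²ξ²», (3.47) p. 279, (1.17) p. 263
«|∂U_n(M˙(𝐔)) − 1| < B₃2α′₀L^{−2n}(L^nξ)² = 2B₃α′₀ξ²» — LOCI of the audited manuscript, TYPE/CONTEXT only (renders p013, p015,
p028–p032 read as images by this seat); nothing of it is used as a hypothesis-free fact.  Under that reading (owner's, to be graded):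

* the carried function of generation `(b,k′)` is ONE function `Fn b k′ : 𝒰 → F` of the (finest-lattice) configuration for every later
  scale — so leaf F-1′ at `k > k′` IS leaf F-1 at `k′` (the continuation factor is `a = 1` identically, not as an estimate);
* the birth chart of generation `(b,k′)` has ITS OWN window norm `Nw b k′`, window `w b k′` and radius `r b k′` (print: «absolute
  constants α₀, α₁» in the birth FRAME; in a common frame the radius scales with the generation), so the transport input is the
  NORMALISED defect of the attaining pairs, `defect b k′ k ≤ c_δ · r b k′ · ψ^{k−k′}` — on the lattice: BOTH carried arguments are
  level-`k` regular on the generation's (collared) block, based-plaquette deviations `≤ aᵢ b k′ · ψ^{k−k′}` with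
  `(d−1)(Lg b k′ − 1)(a₁ b k′ + a₀ b k′) ≤ c_δ · r b k′` (the record's (I4′); printed TYPE [Balaban1985Variational] Thm 1 (8) for
  Bałaban's minimisers, [Balaban1987RGI] (1.17)/(3.41)/(3.47) for the 2-form scaling; asserted here for NOTHING).

* §1 `transportsFrom_of_birthResponse` — `TransportsFrom (4·c_δ) ψ Gate` from: invariance `hinv b k′`, the birth slice `hsl b k′` AT
  BIRTH ONLY (under the history below `k′`), per-generation radii `hr`, normalised defects `hdefw`/`hrate`, attainment `hlin` (engine
  `T4BirthChartTransport.transport_of_birthChart` BY NAME).  NO scale-indexed function, NO (VAL-θ) binder, NO `wOp`.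
* §2 `dressedStabilityStrict_of_sameLattice : DressedStabilityStrict 𝒯 (L^4)` — ROOT-C OF RECORD from ONE K-∕μ-free number set with
  continuation factor `1` (`locOf L 1 (4c_δ) c̄ ≤ ρ′ < 1`) and, per `(p, K)`, §1's data + (w1)+(w5b) `hbirth` + (w5) `hreg` + counts +
  margins (`bookingLeavesOf` + `dressedStabilityStrict_of_bookingLeaves` BY NAME); headline and ROOT-B corollaries.
* §3 `hlin_of_twoSidedRegularity` — on `ℤ^d` (`T4BlockTransport`): the attaining-pair binder of §1 PRODUCED from unitary-like pairs
  with two-sided based-plaquette deviations at the generation-relative rate and the per-generation normalisation above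
  (`T4BlockTransport.relGauge_crude` BY NAME) — (I4′) displayed in the form in which B11 Thm 1 (8) is its printed TYPE.
* §4 `birthSlice_allScales_of_birth` — for a common chart the v1.4 END's scale-indexed `hsl` (sup `1^{k−k′}·gen`) FOLLOWS from
  `hsl` at birth for the constant family `fun b k′ _ => Fn b k′`: the same-lattice face feeds `transportLeaf_of_composition_const`
  at `a = 1` (so v1.4's END of record stands; this file removes a binder, it does not re-base the END).

HONEST FRAMING.  Glue over hypothesis SHAPES.  What the file changes is WHICH binders are displayed: F-1 at birth (cell, (w1)/O-β3-b),
the normalised defect rate of the attaining pairs ((I4′): two-sided level regularity — printed TYPE for Bałaban's backgrounds,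
a hypothesis for the cell's dressed run; collar/domain-match bookkeeping (O2e) unchanged), (w1)+(w5b) births, (w5) regeneration,
counts, arithmetic; (VAL-θ)'s «margin» role does not occur on this face and its «contraction» role IS (I4′).  Whether the dressed run
may be booked this way is the owner's READING (memo §2), to be graded under the two-reader rule; nothing of Bałaban's densities is
instantiated; 0 sorry; no `def`.  «ROOT-C ⇐ the named binders», never «NE1′ proved».  NE1′ NOT printed, NOT proved; spine PROVED
0∕9.  Rung (B)+1 on ONE finite four-torus — NOT infinite volume, NOT a mass gap, NOT OS on ℝ⁴, NOT Clay.  HONEST DEPENDENCY: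
continuum YM on T⁴ ⇐ BetaPertH ∧ nine spine estimates (0/9 proved); BetaPertH ⇐ (D1) ∧ (D4) ∧ CAP+tail; G-an2-4 gates asym, D1
and NE2/3/4.
-/

noncomputable section

namespace Summit.QuantumFields.BalabanUV.T4Continuum.NE1p.DressedRootSameLattice

open Finset
open scoped BigOperators
open Literature.MathematicalPhysics.QuantumFieldTheory.Balaban1983to89
open Literature.MathematicalPhysics.QuantumFieldTheory.Balaban1983to89.T4TermFormat
open Literature.MathematicalPhysics.QuantumFieldTheory.Balaban1983to89.T4TrajectoryComparison
open Literature.MathematicalPhysics.QuantumFieldTheory.Balaban1983to89.T4BirthChartTransport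
  (GaugeInvariant BirthSlice RelGauge transport_of_birthChart)
open Summit.QuantumFields.BalabanUV.T4Continuum.T4TrajectoryDensityDressed
open Summit.QuantumFields.BalabanUV.T4Continuum.NE1p.DressedRoot
open Summit.QuantumFields.BalabanUV.T4Continuum.NE1p.DressedUniformConstants
open Summit.QuantumFields.BalabanUV.T4Continuum.NE1p.DressedRootComposition

/-! ## §1 Transport from the birth response of a FIXED carried function, per-generation charts, normalised defects -/

section BirthResponse

variable {B : T4TermFormat.Booking} {T : Trajectory B}
variable {𝒰 Dir F : Type*} [NormedAddCommGroup F] [NormedSpace ℂ F] [CompleteSpace F]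
  {move : 𝒰 → Dir → ℂ → 𝒰}

/-- **SAME-LATTICE TRANSPORT LEAF** [bookkeeping]: per generation `(b,k′)` ONE carried function `Fn b k′` (no later-scale index),
invariant under the generation's relation (`hinv`), with a birth slice along `move` in the generation's OWN window norm `Nw b k′`,
window `w b k′`, radius `r b k′ > 0`, regular set `𝒦 b k′`, sup `gen b k′` — asked AT THE BIRTH SCALE ONLY, under the history below
`k′` (`hsl`); and, for `j ≤ k′ ≤ k ≤ K` under the history below `k`, the booked size `lin b k′ k` attained up to every `ε > 0` by the
response of THAT function to a pair (base in `𝒦 b k′`, partner in relative gauge) whose defect, in the generation's window norm,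
is in the window and NORMALISED to the radius at the rate `ψ`: `defect b k′ k ≤ c_δ·r b k′·ψ^{k−k′}` (`hdefw`, `hrate`, `hlin`).
THEN `TransportsFrom (4·c_δ) ψ Gate`.  The radius cancels: the constant is the pure number `4c_δ`.  Engine
`transport_of_birthChart` BY NAME; every input a binder; (I4′) is where `hrate` comes from (§3). [folklore] -/
theorem transportsFrom_of_birthResponse {Gate : ℕ → Prop} {Fn : B.Birth → ℕ → 𝒰 → F}
    {rel : B.Birth → ℕ → 𝒰 → 𝒰 → Prop} {𝒦 : B.Birth → ℕ → Set 𝒰} {Nw : B.Birth → ℕ → Dir → ℝ}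
    {w r : B.Birth → ℕ → ℝ} {defect : B.Birth → ℕ → ℕ → ℝ} {cδ ψ : ℝ}
    (hinv : ∀ b k', GaugeInvariant (rel b k') (Fn b k'))
    (hsl : ∀ (b : B.Birth) (k' : ℕ), B.birthScale b ≤ k' → k' ≤ B.K → RanBelow Gate k' →
      BirthSlice (Fn b k') move (Nw b k') (𝒦 b k') (w b k') (r b k') (T.gen b k'))
    (hmove : ∀ U d, move U d 0 = U) (hr : ∀ b k', 0 < r b k')
    (hdefw : ∀ b k' k, defect b k' k ≤ w b k')
    (hrate : ∀ (b : B.Birth) (k' k : ℕ), B.birthScale b ≤ k' → k' ≤ k → k ≤ B.K →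
      defect b k' k ≤ cδ * r b k' * ψ ^ (k - k'))
    (hlin : ∀ (b : B.Birth) (k' k : ℕ), B.birthScale b ≤ k' → k' ≤ k → k ≤ B.K → RanBelow Gate k → ∀ ε > 0,
      ∃ U₀ ∈ 𝒦 b k', ∃ U₁ : 𝒰, RelGauge (rel b k') move (Nw b k') U₀ U₁ (defect b k' k) ∧
        T.lin b k' k ≤ ‖Fn b k' U₁ - Fn b k' U₀‖ + ε) :
    T.TransportsFrom (4 * cδ) ψ Gate := by
  intro b k' k hbk' hk'k hk hran
  refine le_of_forall_pos_le_add fun ε hε => ?_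
  obtain ⟨U₀, hU₀, U₁, hrel, hle⟩ := hlin b k' k hbk' hk'k hk hran ε hε
  have hg : 0 ≤ T.gen b k' := T.gen_nonneg b k'
  have hsl' := hsl b k' hbk' (hk'k.trans hk) (hran.mono hk'k)
  have ht := transport_of_birthChart (hinv b k') hsl' hmove (hr b k') hg hU₀ hrel (hdefw b k' k)
  have hr0 : 0 < r b k' := hr b k'
  have hmono : 4 * T.gen b k' / r b k' * defect b k' k ≤ 4 * cδ * ψ ^ (k - k') * T.gen b k' :=
    calc 4 * T.gen b k' / r b k' * defect b k' k ≤ 4 * T.gen b k' / r b k' * (cδ * r b k' * ψ ^ (k - k')) :=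
          mul_le_mul_of_nonneg_left (hrate b k' k hbk' hk'k hk) (by positivity)
      _ = 4 * cδ * ψ ^ (k - k') * T.gen b k' := by
          field_simp
  linarith

/-- The same leaf in the variable-rate currency of `BookingLeaves.htr` at the constant profile `fun _ => ψ * 1` (the shape
`bookingLeavesOf` consumes with continuation factor `1`). [folklore] -/
theorem transportsFromVar_of_birthResponse {Gate : ℕ → Prop} {Fn : B.Birth → ℕ → 𝒰 → F}
    {rel : B.Birth → ℕ → 𝒰 → 𝒰 → Prop} {𝒦 : B.Birth → ℕ → Set 𝒰} {Nw : B.Birth → ℕ → Dir → ℝ}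
    {w r : B.Birth → ℕ → ℝ} {defect : B.Birth → ℕ → ℕ → ℝ} {cδ ψ : ℝ}
    (hinv : ∀ b k', GaugeInvariant (rel b k') (Fn b k'))
    (hsl : ∀ (b : B.Birth) (k' : ℕ), B.birthScale b ≤ k' → k' ≤ B.K → RanBelow Gate k' →
      BirthSlice (Fn b k') move (Nw b k') (𝒦 b k') (w b k') (r b k') (T.gen b k'))
    (hmove : ∀ U d, move U d 0 = U) (hr : ∀ b k', 0 < r b k')
    (hdefw : ∀ b k' k, defect b k' k ≤ w b k')
    (hrate : ∀ (b : B.Birth) (k' k : ℕ), B.birthScale b ≤ k' → k' ≤ k → k ≤ B.K →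
      defect b k' k ≤ cδ * r b k' * ψ ^ (k - k'))
    (hlin : ∀ (b : B.Birth) (k' k : ℕ), B.birthScale b ≤ k' → k' ≤ k → k ≤ B.K → RanBelow Gate k → ∀ ε > 0,
      ∃ U₀ ∈ 𝒦 b k', ∃ U₁ : 𝒰, RelGauge (rel b k') move (Nw b k') U₀ U₁ (defect b k' k) ∧
        T.lin b k' k ≤ ‖Fn b k' U₁ - Fn b k' U₀‖ + ε) :
    T.TransportsFromVar (4 * cδ) (fun _ : ℕ => ψ * 1) Gate := by
  rw [Trajectory.transportsFromVar_const_iff, mul_one]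
  exact transportsFrom_of_birthResponse hinv hsl hmove hr hdefw hrate hlin

end BirthResponse

/-! ## §2 ROOT-C of record on the same-lattice face -/

section Root

variable {P : Type*} (𝒯 : DressedTower P)
variable {𝒰 Dir F : Type*} [NormedAddCommGroup F] [NormedSpace ℂ F] [CompleteSpace F]
  {move : 𝒰 → Dir → ℂ → 𝒰}

/-- **ROOT-C OF RECORD ON THE SAME-LATTICE FACE** [bookkeeping]: ONE K-∕μ-free number set — block size `L ≥ 1`, normalised defect
constant `c_δ ≥ 0`, regeneration bound `c̄ ≥ 0`, multiplicity `N₀`, amplitude `A₀`, source factor `m`, margin bound `s̄⁰`, located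
largeness WITH CONTINUATION FACTOR ONE `locOf L 1 (4c_δ) c̄ = 1/L + L·(4c_δ)·c̄ ≤ ρ′ < 1` ((w7)), window (w6) — and, at EVERY run
parameter and cutoff: per generation ONE carried function `Fn p K b k′` with its invariance `hinv` and its birth slice `hsl` AT BIRTH
(per-generation window norm ∕ window ∕ radius), the attaining pairs with NORMALISED defects at rate `L⁻²` (`hdefw`, `hrate`, `hlin` —
(I4′)), the births leaf (w1)+(w5b) `hbirth`, the regeneration leaf (w5) `hreg` (`0 ≤ c ≤ c̄`), counts (w3-book) at rate `L⁴`, margins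
`s₀ ≤ s̄⁰` (free to be `≡ 0` here) ⟹ `DressedStabilityStrict 𝒯 (L^4)`.  NO scale-indexed carried function, NO (VAL-θ) binder, NO
density-layer binder.  «ROOT-C ⇐ the named binders», NOT «NE1′ proved». [folklore] -/
theorem dressedStabilityStrict_of_sameLattice {L cδ cbar N₀ A₀ m sbar ρ' : ℝ} (hL : 1 ≤ L) (hcδ : 0 ≤ cδ)
    (hcbar : 0 ≤ cbar) (hN₀ : 0 ≤ N₀) (hA₀ : 0 ≤ A₀) (hm : 0 ≤ m)
    (hloc : locOf L 1 (4 * cδ) cbar ≤ ρ') (hρ'1 : ρ' < 1) (hsmall : m * (N₀ * A₀ * (1 - ρ')⁻¹) ≤ 1 - sbar)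
    (c : P → ℕ → ℕ → ℝ) (s₀ : ∀ p K, (𝒯.B p K).Birth → ℕ → ℝ)
    (S : ∀ p K, ℕ → (𝒯.B p K).Birth → Finset (𝒯.B p K).Birth)
    (hc0 : ∀ p K k, 0 ≤ c p K k) (hcb : ∀ p K k, k < (𝒯.B p K).K → c p K k ≤ cbar)
    (hS : ∀ p K k b, ∀ f ∈ S p K k b, (𝒯.B p K).birthScale f ≤ k)
    (hcount : ∀ p K k b, ∀ j ≤ k,
      ((((S p K k b).filter fun f => (𝒯.B p K).birthScale f = j).card : ℝ)) ≤ N₀ * (L ^ 4) ^ (k - j))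
    (hs₀ : ∀ p K b k, s₀ p K b k ≤ sbar)
    (hbirth : ∀ p K, (𝒯.T p K).BirthsFromOld (4 * cδ) (fun _ : ℕ => (L ^ 2)⁻¹ * 1)
      (twoRate A₀ (rhoOneOf (L ^ 2)⁻¹ 1 (4 * cδ) cbar) (L⁻¹ ^ 3) (𝒯.B p K).K)
      (budgetGate (𝒯.T p K) (s₀ p K) m (S p K) (4 * cδ) (fun _ : ℕ => (L ^ 2)⁻¹ * 1)))
    (hreg : ∀ p K, (𝒯.T p K).RegeneratesFromVar (c p K)
      (budgetGate (𝒯.T p K) (s₀ p K) m (S p K) (4 * cδ) (fun _ : ℕ => (L ^ 2)⁻¹ * 1)))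
    -- the same-lattice function-level transport data, per run parameter and cutoff
    (Fn : ∀ p K, (𝒯.B p K).Birth → ℕ → 𝒰 → F) (rel : ∀ p K, (𝒯.B p K).Birth → ℕ → 𝒰 → 𝒰 → Prop)
    (𝒦 : ∀ p K, (𝒯.B p K).Birth → ℕ → Set 𝒰) (Nw : ∀ p K, (𝒯.B p K).Birth → ℕ → Dir → ℝ)
    (w r : ∀ p K, (𝒯.B p K).Birth → ℕ → ℝ) (defect : ∀ p K, (𝒯.B p K).Birth → ℕ → ℕ → ℝ)
    (hinv : ∀ p K b k', GaugeInvariant (rel p K b k') (Fn p K b k'))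
    (hsl : ∀ p K (b : (𝒯.B p K).Birth) (k' : ℕ), (𝒯.B p K).birthScale b ≤ k' → k' ≤ (𝒯.B p K).K →
      RanBelow (budgetGate (𝒯.T p K) (s₀ p K) m (S p K) (4 * cδ) (fun _ : ℕ => (L ^ 2)⁻¹ * 1)) k' →
      BirthSlice (Fn p K b k') move (Nw p K b k') (𝒦 p K b k') (w p K b k') (r p K b k') ((𝒯.T p K).gen b k'))
    (hmove : ∀ U d, move U d 0 = U) (hr : ∀ p K b k', 0 < r p K b k')
    (hdefw : ∀ p K b k' k, defect p K b k' k ≤ w p K b k')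
    (hrate : ∀ p K (b : (𝒯.B p K).Birth) (k' k : ℕ), (𝒯.B p K).birthScale b ≤ k' → k' ≤ k → k ≤ (𝒯.B p K).K →
      defect p K b k' k ≤ cδ * r p K b k' * ((L ^ 2)⁻¹) ^ (k - k'))
    (hlin : ∀ p K (b : (𝒯.B p K).Birth) (k' k : ℕ), (𝒯.B p K).birthScale b ≤ k' → k' ≤ k → k ≤ (𝒯.B p K).K →
      RanBelow (budgetGate (𝒯.T p K) (s₀ p K) m (S p K) (4 * cδ) (fun _ : ℕ => (L ^ 2)⁻¹ * 1)) k → ∀ ε > 0,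
      ∃ U₀ ∈ 𝒦 p K b k', ∃ U₁ : 𝒰, RelGauge (rel p K b k') move (Nw p K b k') U₀ U₁ (defect p K b k' k) ∧
        (𝒯.T p K).lin b k' k ≤ ‖Fn p K b k' U₁ - Fn p K b k' U₀‖ + ε) :
    DressedStabilityStrict 𝒯 (L ^ 4) := by
  have hC : 0 ≤ 4 * cδ := by positivity
  have h := dressedStabilityStrict_of_bookingLeaves
    (uniformConstantsOf L 1 (4 * cδ) cbar N₀ A₀ m sbar ρ' hL zero_le_one hC hcbar hN₀ hA₀ hm hloc hρ'1 hsmall) 𝒯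
    (fun p K => bookingLeavesOf hL zero_le_one hC hcbar hN₀ hA₀ hm hloc hρ'1 hsmall (c p K) (s₀ p K) (S p K)
      (hc0 p K) (hcb p K) (hS p K) (hcount p K) (hs₀ p K) (hbirth p K)
      (transportsFromVar_of_birthResponse (T := 𝒯.T p K) (hinv p K) (hsl p K) hmove (hr p K) (hdefw p K)
        (hrate p K) (hlin p K))
      (hreg p K))
  simpa using h

/-- **THE LOCATED LARGENESS AT CONTINUATION FACTOR ONE** [arith]: `locOf L 1 (4c_δ) c̄ = 1/L + 4·L·c_δ·c̄`; (w7) asks `< 1`, i.e.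
`1 < L` and a SMALL product «normalised defect constant × regeneration constant», `4·L·c_δ·c̄ < 1 − 1/L`
(`DressedRootComposition.one_lt_of_composition_cell` pattern).  Decided arithmetic of the cell's shapes. -/
theorem locOf_one_eq (L cδ cbar : ℝ) : locOf L 1 (4 * cδ) cbar = 1 / L + 4 * L * cδ * cbar := by
  unfold locOf; ring

/-- … and a sufficient smallness: `2 ≤ L` and `16·L·c_δ·c̄ ≤ 1` give `locOf L 1 (4c_δ) c̄ ≤ 3/4`. [arith] -/
theorem locOf_one_le_of_small {L cδ cbar : ℝ} (hL : 2 ≤ L) (hsmall : 16 * L * cδ * cbar ≤ 1) :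
    locOf L 1 (4 * cδ) cbar ≤ 3 / 4 := by
  rw [locOf_one_eq]
  have hL0 : 0 < L := by linarith
  have h1 : 1 / L ≤ 1 / 2 := by
    rw [div_le_div_iff₀ hL0 (by norm_num : (0:ℝ) < 2)]; linarith
  have h2 : 4 * L * cδ * cbar ≤ 1 / 4 := by linarith
  linarith

/-- **HEADLINE ON THE SAME-LATTICE FACE** [bookkeeping]: ROOT-C (strict) ⟹ `DressedStability 𝒯` (`dressedStability_of_strict` BY NAME).
[folklore] -/
theorem dressedStability_of_sameLattice_strict {L : ℝ} (h : DressedStabilityStrict 𝒯 (L ^ 4)) : DressedStability 𝒯 :=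
  dressedStability_of_strict h

/-- **ROOT-B ON THE SAME-LATTICE FACE** [bookkeeping]: ROOT-C (strict) with positional counts `N₀·(L⁴)^{k−j}` and bounded nonnegative
weights ⟹ `DressedBudget 𝒯 w` (`dressedBudget_of_dressedStabilityStrict` BY NAME). [folklore] -/
theorem dressedBudget_of_sameLattice_strict {L N₀ wbar : ℝ} {wt : P → ℕ → ℕ → ℝ}
    (h : DressedStabilityStrict 𝒯 (L ^ 4)) (hN₀ : 0 ≤ N₀) (hwbar : 0 ≤ wbar)
    (hw0 : ∀ p K, ∀ j ≤ K, 0 ≤ wt p K j) (hwb : ∀ p K, ∀ j ≤ K, wt p K j ≤ wbar)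
    (hcount : ∀ p K, (𝒯.B p K).PositionalCount fun j k => N₀ * (L ^ 4) ^ (k - j)) :
    DressedBudget 𝒯 wt :=
  dressedBudget_of_dressedStabilityStrict h hN₀ hwbar hw0 hwb hcount

end Root

/-! ## §3 (I4′) displayed on the lattice: the attaining pairs from two-sided level regularity -/

section Lattice

open T4RelativeLadder (UnitaryLike)
open T4RelativeComb (Cfg plaq PlaqSup)
open T4BlockTransport (Fld val latMove latN BlockRel relGauge_crude)

variable {B : T4TermFormat.Booking} {T : Trajectory B}
variable {R : Type*} [NormedRing R] [NormOneClass R] [NormedAlgebra ℂ R] {d : ℕ}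
  {F : Type*} [NormedAddCommGroup F]

/-- **(I4′) ⇒ THE ATTAINING-PAIR BINDER OF §1, ON `ℤ^d`** [bookkeeping]: per generation `(b,k′)` a block (side `Lg b k′`, corner
`zg b k′`), based-plaquette amplitudes `a₀ b k′, a₁ b k′` with `0 < a₁ + a₀`, a radius `r b k′`, and the per-generation NORMALISATION
`(d−1)·(Lg b k′ − 1)·(a₁ b k′ + a₀ b k′) ≤ c_δ·r b k′` with `0 < c_δ`, `0 < r b k′` (in the same-lattice reading: block side
`∝ L^{k′}` fine bonds, per-fine-plaquette regularity `∝ L^{−2k′}`, radius `∝ L^{−k′}` — the `k′`-dependences cancel; a smallness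
relation among birth constants of the TYPE «B₃²O(1)Mα₀ < ½α₁», [Balaban1987RGI] p. 277); `0 < ψ`; and, under the history,
the booked size attained by the response to a UNITARY-LIKE pair, base regular, BOTH partners with based-plaquette deviations on the
block `≤ aᵢ b k′·ψ^{k−k′}` — two-sided level regularity at the generation-relative rate (printed TYPE [Balaban1985Variational] Thm 1 (8)
for Bałaban's minimisers; a binder here).  THEN §1's `hlin` holds on the affine chart (`latMove`, `latN`) for the block relation
`BlockRel`, with `defect b k′ k := c_δ·r b k′·ψ^{k−k′}` (so `hrate` is `le_rfl` and `hdefw` is `c_δ·r b k′ ≤ w b k′`).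
`T4BlockTransport.relGauge_crude` BY NAME. [folklore] -/
theorem hlin_of_twoSidedRegularity {Gate : ℕ → Prop} {Fn : B.Birth → ℕ → Fld d R → F}
    {Lg : B.Birth → ℕ → ℕ} {zg : B.Birth → ℕ → T4BlockTransport.Site d} {𝒦 : B.Birth → ℕ → Set (Fld d R)}
    {a₀ a₁ r : B.Birth → ℕ → ℝ} {cδ ψ : ℝ}
    (hcδ : 0 < cδ) (hr : ∀ b k', 0 < r b k') (hψ : 0 < ψ) (ha : ∀ b k', 0 < a₁ b k' + a₀ b k')
    (hnorm : ∀ b k', ((d : ℝ) - 1) * ((Lg b k' : ℝ) - 1) * (a₁ b k' + a₀ b k') ≤ cδ * r b k')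
    (hpair : ∀ (b : B.Birth) (k' k : ℕ), B.birthScale b ≤ k' → k' ≤ k → k ≤ B.K → RanBelow Gate k → ∀ ε > 0,
      ∃ U₀ U₁ : Cfg d R, val U₀ ∈ 𝒦 b k' ∧ (∀ x ν, UnitaryLike (U₀ x ν)) ∧ (∀ x ν, UnitaryLike (U₁ x ν)) ∧
        PlaqSup (Lg b k') (zg b k') (fun y ρ ν => ‖(plaq U₁ y ρ ν : R) - 1‖) (a₁ b k' * ψ ^ (k - k')) ∧
        PlaqSup (Lg b k') (zg b k') (fun y ρ ν => ‖(plaq U₀ y ρ ν : R) - 1‖) (a₀ b k' * ψ ^ (k - k')) ∧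
        T.lin b k' k ≤ ‖Fn b k' (val U₁) - Fn b k' (val U₀)‖ + ε) :
    ∀ (b : B.Birth) (k' k : ℕ), B.birthScale b ≤ k' → k' ≤ k → k ≤ B.K → RanBelow Gate k → ∀ ε > 0,
      ∃ U₀ ∈ 𝒦 b k', ∃ U₁ : Fld d R, RelGauge (BlockRel (Lg b k') (zg b k')) latMove latN U₀ U₁
          (cδ * r b k' * ψ ^ (k - k')) ∧
        T.lin b k' k ≤ ‖Fn b k' U₁ - Fn b k' U₀‖ + ε := by
  intro b k' k hbk' hk'k hk hran ε hε
  obtain ⟨U₀, U₁, hU₀𝒦, hU₀, hU₁, hq₁, hq₀, hle⟩ := hpair b k' k hbk' hk'k hk hran ε hε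
  refine ⟨val U₀, hU₀𝒦, val U₁, ?_, hle⟩
  have hpow0 : 0 < ψ ^ (k - k') := pow_pos hψ _
  have hsum : a₁ b k' * ψ ^ (k - k') + a₀ b k' * ψ ^ (k - k') = (a₁ b k' + a₀ b k') * ψ ^ (k - k') := by ring
  have hq : 0 ≤ a₁ b k' * ψ ^ (k - k') + a₀ b k' * ψ ^ (k - k') := by
    rw [hsum]; exact mul_nonneg (ha b k').le hpow0.le
  refine relGauge_crude hU₀ hU₁ hq₁ hq₀ hq ?_ (mul_pos (mul_pos hcδ (hr b k')) hpow0)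
  calc ((d : ℝ) - 1) * ((Lg b k' : ℝ) - 1) * (a₁ b k' * ψ ^ (k - k') + a₀ b k' * ψ ^ (k - k'))
      = (((d : ℝ) - 1) * ((Lg b k' : ℝ) - 1) * (a₁ b k' + a₀ b k')) * ψ ^ (k - k') := by rw [hsum]; ring
    _ ≤ (cδ * r b k') * ψ ^ (k - k') := mul_le_mul_of_nonneg_right (hnorm b k') hpow0.le
    _ = cδ * r b k' * ψ ^ (k - k') := by ring

/-- With the defect SET to `c_δ·r·ψ^{k−k′}` the window binder of §1 is the per-generation smallness `c_δ·r b k′ ≤ w b k′`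
(`ψ ≤ 1`). [arith] -/
theorem hdefw_of_window {r w : B.Birth → ℕ → ℝ} {cδ ψ : ℝ} (hcδ : 0 ≤ cδ) (hr : ∀ b k', 0 ≤ r b k')
    (hψ : 0 ≤ ψ) (hψ1 : ψ ≤ 1) (hw : ∀ b k', cδ * r b k' ≤ w b k') :
    ∀ (b : B.Birth) (k' k : ℕ), cδ * r b k' * ψ ^ (k - k') ≤ w b k' := by
  intro b k' k
  have hpow : ψ ^ (k - k') ≤ 1 := pow_le_one₀ hψ hψ1
  calc cδ * r b k' * ψ ^ (k - k') ≤ cδ * r b k' * 1 :=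
        mul_le_mul_of_nonneg_left hpow (mul_nonneg hcδ (hr b k'))
    _ ≤ w b k' := by rw [mul_one]; exact hw b k'

end Lattice

/-! ## §4 The v1.4 END is fed: the scale-indexed birth slice of a constant family -/

section Feed

variable {B : T4TermFormat.Booking} {T : Trajectory B}
variable {𝒰 Dir F : Type*} [NormedAddCommGroup F] [NormedSpace ℂ F] [CompleteSpace F]
  {move : 𝒰 → Dir → ℂ → 𝒰} {N : Dir → ℝ} {w r : ℝ}

omit [CompleteSpace F] in
/-- **F-1′ IS F-1 FOR A FIXED CARRIED FUNCTION** [bookkeeping]: on a common chart, the birth slice asked AT BIRTH under the history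
below `k′` gives the scale-indexed binder `hsl` of `DressedRootComposition.transportLeaf_of_composition_const` at continuation factor
`a = 1` for the constant family `fun b k′ _ => Fn b k′` (histories restrict, `1^{k−k′} = 1`).  So the composition-route END of record
(skeleton v1.4) is fed by the same-lattice data with NO later-scale estimate. [folklore] -/
theorem birthSlice_allScales_of_birth {Gate : ℕ → Prop} {Fn : B.Birth → ℕ → 𝒰 → F} {𝒦 : B.Birth → ℕ → Set 𝒰}
    (hsl : ∀ (b : B.Birth) (k' : ℕ), B.birthScale b ≤ k' → k' ≤ B.K → RanBelow Gate k' →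
      BirthSlice (Fn b k') move N (𝒦 b k') w r (T.gen b k')) :
    ∀ (b : B.Birth) (k' k : ℕ), B.birthScale b ≤ k' → k' ≤ k → k ≤ B.K → RanBelow Gate k →
      BirthSlice ((fun b k' (_ : ℕ) => Fn b k') b k' k) move N (𝒦 b k') w r ((1 : ℝ) ^ (k - k') * T.gen b k') := by
  intro b k' k hbk' hk'k hk hran
  rw [one_pow, one_mul]
  exact hsl b k' hbk' (hk'k.trans hk) (hran.mono hk'k)

/-- … hence the v1.4 transport leaf at `a = 1` from same-lattice data on a common chart (`transportLeaf_of_composition_const` BY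
NAME): `TransportsFromVar (4c_δ/r) (fun _ => ψ·1)` gated by the dressed budget. [folklore] -/
theorem transportLeaf_v14_of_sameLattice {Fn : B.Birth → ℕ → 𝒰 → F} {rel : B.Birth → ℕ → 𝒰 → 𝒰 → Prop}
    {𝒦 : B.Birth → ℕ → Set 𝒰} {defect : B.Birth → ℕ → ℕ → ℝ} {cδ ψ m : ℝ}
    {s : B.Birth → ℕ → ℝ} {S : ℕ → B.Birth → Finset B.Birth}
    (hinv : ∀ b k', GaugeInvariant (rel b k') (Fn b k'))
    (hsl : ∀ (b : B.Birth) (k' : ℕ), B.birthScale b ≤ k' → k' ≤ B.K →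
      RanBelow (budgetGate T s m S (4 * cδ / r) (fun _ : ℕ => ψ * 1)) k' →
      BirthSlice (Fn b k') move N (𝒦 b k') w r (T.gen b k'))
    (hmove : ∀ U d, move U d 0 = U) (hr : 0 < r) (hdefw : ∀ b k' k, defect b k' k ≤ w)
    (hrate : ∀ (b : B.Birth) (k' k : ℕ), B.birthScale b ≤ k' → k' ≤ k → k ≤ B.K →
      defect b k' k ≤ cδ * ψ ^ (k - k'))
    (hlin : ∀ (b : B.Birth) (k' k : ℕ), B.birthScale b ≤ k' → k' ≤ k → k ≤ B.K →
      RanBelow (budgetGate T s m S (4 * cδ / r) (fun _ : ℕ => ψ * 1)) k → ∀ ε > 0,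
      ∃ U₀ ∈ 𝒦 b k', ∃ U₁ : 𝒰, RelGauge (rel b k') move N U₀ U₁ (defect b k' k) ∧
        T.lin b k' k ≤ ‖Fn b k' U₁ - Fn b k' U₀‖ + ε) :
    T.TransportsFromVar (4 * cδ / r) (fun _ : ℕ => ψ * 1)
      (budgetGate T s m S (4 * cδ / r) (fun _ : ℕ => ψ * 1)) :=
  transportLeaf_of_composition_const (Fn := fun b k' (_ : ℕ) => Fn b k') zero_le_one
    (fun b k' _ => hinv b k') (birthSlice_allScales_of_birth (T := T) hsl) hmove hr hdefw hrate
    (fun b k' k hbk' hk'k hk hran ε hε => hlin b k' k hbk' hk'k hk hran ε hε)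

end Feed

end Summit.QuantumFields.BalabanUV.T4Continuum.NE1p.DressedRootSameLattice

end
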